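import Mathlib.Algebra.Homology.DerivedCategory.HomologySequence
import Mathlib.Algebra.Category.ModuleCat.Abelian
import Mathlib.Algebra.Category.ModuleCat.Biproducts
import Mathlib.Algebra.Homology.ShortComplex.ModuleCat
import HarnessLib

/-!
# A mod-`p` quasi-isomorphism in a range is integral on bounded `p`-torsion (X. Hu, Lemma 10.2)

X. Hu, *On the algebraic `K`-theory of smooth schemes over truncated Witt vectors*
(arXiv:2507.12458, 2025), Lemma 10.2 (p. 52, "a simple fact in homological algebra"), is the step
of the proof of the infinitesimal Chern character isomorphism (Thm. 10.1 ⇒ Cor. 10.5) that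
upgrades the MOD-`p` comparison `(𝒦/p)_{X_n,X_{n-1},i} ≅ ⊕ ℋ^{2r-i-1}(p^{r,n-1}_{r,n}Ω• ⊗ᴸ ℤ/p)`
(Prop. 10.3) to the INTEGRAL one, both sides being `p`-primary torsion of bounded exponent:

> **Lemma 10.2.** Let `C → D` be a map of chain complexes of abelian groups which are bounded
> from below. Let `n ∈ ℤ`. Assume that the induced homomorphisms `Hᵢ(C; ℤ/p) → Hᵢ(D; ℤ/p)` are
> isomorphisms for `i ≤ n` and surjective for `i ≤ n + 1`. Assume moreover that for `i ≤ n + 1`,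
> `Hᵢ(C)` and `Hᵢ(D)` are `p^M`-torsion for some `M ∈ ℕ`. Then the homomorphisms
> `Hᵢ(C) → Hᵢ(D)` also satisfy [the same condition].

This file PROVES it (no named facts), in two layers.

* **The abelian-group core** (`injective_of_bockstein_ladder`, `surjective_of_bockstein_ladder`):
  the lemma is "degreewise local" — it only involves two consecutive degrees and the two
  universal-coefficient (Bockstein) sequences `H →ⁿ H →ι H(-; ℤ/n) →δ H' →ⁿ H'` of source and
  target with the ladder maps between them; so it is stated for arbitrary additive groups and
  homomorphisms with exactly the exactness properties used (kernel of `ι` divisible by `n`,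
  `n`-torsion classes are Bocksteins, Bocksteins are `n`-torsion, `δ ∘ ι = 0`, exactness at the
  mod-`n` group). INJECTIVITY in degree `q`: if the mod-`n` map is injective in degree `q` and onto
  in the degree feeding the Bockstein into degree `q`, every class of the kernel is `n` times a
  class of the kernel, hence `0` when the source group is `n^M`-torsion. SURJECTIVITY in degree `q`:
  if the mod-`n` map is onto in degree `q` and the integral map is injective in the next degree,
  the target is `image + n · target`, hence the image when the target is `n^M`-torsion. In this
  form the core also applies verbatim to homotopy groups of spectra with their mod-`n` Moore
  sequences (the shape in which Hu uses it for the `K`-theory side), once those exist.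
* **Complexes** (`CochainComplex (ModuleCat R) ℤ`, any ring `R`; abelian groups = `R = ℤ`): the
  mod-`n` cohomology `H^q(K; ℤ/n)` is the cohomology of `modCone K n := Cone(n · 𝟙_K)` — the
  standard model of `K ⊗ᴸ ℤ/n` (`ℤ/n = Cone(ℤ →ⁿ ℤ)`; for a degreewise `n`-torsion-free `K` it is
  quasi-isomorphic to `K/nK`), which is what "`Hᵢ(C; ℤ/p)`" means for the non-free complexes of
  the source (computed there through flat resolutions, e.g. proof of Lemma 6.4). Its long exact
  sequence (Mathlib: the distinguished triangle of a mapping cone in the derived category,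
  `CochainComplex.homologyMap_exact₁/₂/₃_of_distTriang`, `homologyδOfTriangle`) supplies the
  Bockstein data (`modConeι`, `modConeδ` and the lemmas `exists_zsmul_eq_of_modConeι_apply_eq_zero`,
  `exists_modConeι_apply_eq_of_modConeδ_apply_eq_zero`, `exists_modConeδ_apply_eq_of_zsmul_eq_zero`,
  `zsmul_modConeδ_apply`, `modConeδ_apply_modConeι_apply`, naturality
  `modConeMap_apply_modConeι_apply`, `homologyMap_apply_modConeδ_apply`), and the core gives
  `homologyMap_injective_of_modConeMap`, `homologyMap_surjective_of_modConeMap` and the lemma as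
  printed, `homologyMap_bijective_of_modConeMap_bijective` — in COHOMOLOGICAL indexing
  (`Kq = C₋q`: "isomorphism for `q ≥ q₀`, onto in degree `q₀ - 1`", torsion hypothesis for
  `q ≥ q₀ - 1`). The printed hypothesis "bounded from below" is not needed and is dropped; `n`
  need not be prime.

Mathlib searched (pin): `CochainComplex.mappingCone`, `mappingCone.map`, `mappingCone.triangleMap`,
`DerivedCategory.mappingCone_triangle_distinguished`, `CochainComplex.homologyδOfTriangle`,
`homologyMap_exact₁_of_distTriang`, `Functor.shiftMap_comp`, `ShortComplex.moduleCat_exact_iff`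
(used); Mathlib has no universal coefficient theorem / mod-`n` homology of complexes as such.

## References

* X. Hu, *On the algebraic `K`-theory of smooth schemes over truncated Witt vectors*,
  arXiv:2507.12458 (2025), Lemma 10.2, p. 52. [Hu2025TruncatedWitt]
-/

universe v u

namespace Literature.Algebra.Homology

/-! ### The abelian-group core: Bockstein ladders -/

section Core

variable {A B P P' Q Q' A' B' : Type*} [AddCommGroup A] [AddCommGroup B] [AddCommGroup P]
  [AddCommGroup P'] [AddCommGroup Q] [AddCommGroup Q'] [AddCommGroup A'] [AddCommGroup B']

/-- **Injectivity half of Hu's Lemma 10.2, group-theoretic core.** Data: the integral map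
`f : A → B` in one degree; the reductions `αA : A → P`, `αB : B → P'` into the mod-`n` groups of
that degree with the mod-`n` map `gP : P → P'` over `f`; the Bocksteins `βA : Q → A`, `βB : Q' → B`
out of the mod-`n` groups of the preceding degree with the mod-`n` map `gQ : Q → Q'` under `f`.
Hypotheses: `Ker αA ⊆ n·A` (exactness of `A →ⁿ A → P`), `n·βA = 0` and `B[n] ⊆ Im βB` (exactness
of `Q → A →ⁿ A`, resp. `Q' → B →ⁿ B`), `gP` injective, `gQ` onto, `A` killed by `n^M`. Then `f` is
injective: a class `a` of the kernel reduces to `0` (as `gP` is injective), so `a = n·a₁`; `f a₁`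
is `n`-torsion, hence a Bockstein `βB y = βB (gQ x)`, and `a₁ - βA x` is again in the kernel with
`n·(a₁ - βA x) = a`; iterating `M` times, `a ∈ n^M · Ker f = 0`.
[cite: Hu2025TruncatedWitt, Lemma 10.2 (p. 52)] -/
theorem injective_of_bockstein_ladder (n : ℤ) (M : ℕ) (f : A →+ B)
    (αA : A →+ P) (αB : B →+ P') (gP : P →+ P') (hα : ∀ a, gP (αA a) = αB (f a))
    (βA : Q →+ A) (βB : Q' →+ B) (gQ : Q →+ Q') (hβ : ∀ x, f (βA x) = βB (gQ x))
    (hkerαA : ∀ a, αA a = 0 → ∃ a', a = n • a') (hβA : ∀ x, n • βA x = 0)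
    (hβB : ∀ b, n • b = 0 → ∃ y, βB y = b)
    (hgP : Function.Injective gP) (hgQ : Function.Surjective gQ)
    (hA : ∀ a : A, n ^ M • a = 0) :
    Function.Injective f := by
  -- every class of the kernel is `n` times a class of the kernel
  have key : ∀ a, f a = 0 → ∃ a₂, f a₂ = 0 ∧ a = n • a₂ := by
    intro a ha
    have h1 : αA a = 0 := hgP (by rw [hα, ha, map_zero, map_zero])
    obtain ⟨a₁, rfl⟩ := hkerαA a h1
    have h2 : n • f a₁ = 0 := by rw [← map_zsmul]; exact ha
    obtain ⟨y, hy⟩ := hβB (f a₁) h2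
    obtain ⟨x, rfl⟩ := hgQ y
    refine ⟨a₁ - βA x, ?_, ?_⟩
    · rw [map_sub, hβ, hy, sub_self]
    · rw [smul_sub, hβA, sub_zero]
  have iter : ∀ (k : ℕ) (a), f a = 0 → ∃ a', f a' = 0 ∧ a = n ^ k • a' := by
    intro k
    induction k with
    | zero => exact fun a ha ↦ ⟨a, ha, by rw [pow_zero, one_smul]⟩
    | succ k ih =>
      intro a ha
      obtain ⟨a', ha', rfl⟩ := ih a ha
      obtain ⟨a'', ha'', rfl⟩ := key a' ha'
      exact ⟨a'', ha'', by rw [smul_smul, ← pow_succ]⟩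
  refine (injective_iff_map_eq_zero f).2 fun a ha ↦ ?_
  obtain ⟨a', -, rfl⟩ := iter M a ha
  exact hA a'

/-- **Surjectivity half of Hu's Lemma 10.2, group-theoretic core.** Data: the integral maps
`f : A → B` in one degree and `f' : A' → B'` in the following degree; the reductions
`αA : A → P`, `αB : B → P'` into the mod-`n` groups with the mod-`n` map `gP : P → P'` over `f`,
and the Bocksteins `δA : P → A'`, `δB : P' → B'` under which `gP` lies over `f'`. Hypotheses:
exactness of `A → P → A'` at `P`, `δB ∘ αB = 0`, `Ker αB ⊆ n·B` (exactness of `B →ⁿ B → P'`),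
`gP` onto, `f'` injective, `B` killed by `n^M`. Then `f` is onto: for `b ∈ B` write
`αB b = gP x`; then `f' (δA x) = δB (αB b) = 0`, so `δA x = 0` (injectivity of `f'`), `x = αA a`,
and `b - f a` reduces to `0`, i.e. lies in `n·B`; hence `B = Im f + n·B = Im f + n^M·B = Im f`.
[cite: Hu2025TruncatedWitt, Lemma 10.2 (p. 52)] -/
theorem surjective_of_bockstein_ladder (n : ℤ) (M : ℕ) (f : A →+ B) (f' : A' →+ B')
    (αA : A →+ P) (αB : B →+ P') (gP : P →+ P') (hα : ∀ a, gP (αA a) = αB (f a))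
    (δA : P →+ A') (δB : P' →+ B') (hδ : ∀ x, f' (δA x) = δB (gP x))
    (hexA : ∀ x, δA x = 0 → ∃ a, αA a = x) (hδαB : ∀ b, δB (αB b) = 0)
    (hkerαB : ∀ b, αB b = 0 → ∃ b', b = n • b')
    (hgP : Function.Surjective gP) (hf' : Function.Injective f')
    (hB : ∀ b : B, n ^ M • b = 0) :
    Function.Surjective f := by
  -- `B = Im f + n • B`
  have key : ∀ b, ∃ a b', b = f a + n • b' := by
    intro b
    obtain ⟨x, hx⟩ := hgP (αB b)
    have h1 : δA x = 0 := hf' (by rw [hδ, hx, hδαB, map_zero])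
    obtain ⟨a, rfl⟩ := hexA x h1
    have h2 : αB (b - f a) = 0 := by rw [map_sub, ← hα, hx, sub_self]
    obtain ⟨b', hb'⟩ := hkerαB _ h2
    exact ⟨a, b', by rw [← hb', add_sub_cancel]⟩
  have iter : ∀ (k : ℕ) (b), ∃ a b', b = f a + n ^ k • b' := by
    intro k
    induction k with
    | zero => exact fun b ↦ ⟨0, b, by rw [map_zero, zero_add, pow_zero, one_smul]⟩
    | succ k ih =>
      intro b
      obtain ⟨a, b', rfl⟩ := ih b
      obtain ⟨a', b'', hb'⟩ := key b'
      refine ⟨a + n ^ k • a', b'', ?_⟩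
      rw [hb', smul_add, smul_smul, ← pow_succ, map_add, map_zsmul, add_assoc]
  intro b
  obtain ⟨a, b', rfl⟩ := iter M b
  exact ⟨a, by rw [hB, add_zero]⟩

end Core

/-! ### Mod-`n` cohomology of a complex of modules: the cone of multiplication by `n` -/

section Complexes

open CategoryTheory CategoryTheory.Limits HomologicalComplex CochainComplex

variable {R : Type u} [Ring R]

/-- `g (f x) = 0` from `f ≫ g = 0` in `ModuleCat`. [folklore] -/
private theorem apply_apply_eq_zero_of_comp_eq_zero {X Y Z : ModuleCat.{v} R} {f : X ⟶ Y}
    {g : Y ⟶ Z} (h : f ≫ g = 0) (x : X) : g (f x) = 0 := by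
  have := congrArg (fun k : X ⟶ Z ↦ k x) h
  simpa using this

/-- `g (f x) = g' (f' x)` from `f ≫ g = f' ≫ g'` in `ModuleCat`. [folklore] -/
private theorem apply_apply_eq_of_comp_eq {X Y Y' Z : ModuleCat.{v} R} {f : X ⟶ Y} {g : Y ⟶ Z}
    {f' : X ⟶ Y'} {g' : Y' ⟶ Z} (h : f ≫ g = f' ≫ g') (x : X) : g (f x) = g' (f' x) := by
  have := congrArg (fun k : X ⟶ Z ↦ k x) h
  simpa using this

/-- `H^q(n • φ) = n • H^q(φ)` (additivity of `H^q`). [folklore] -/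
theorem homologyMap_zsmul {K L : CochainComplex (ModuleCat.{v} R) ℤ} (φ : K ⟶ L) (n q : ℤ) :
    homologyMap (n • φ) q = n • homologyMap φ q :=
  (homologyFunctor (ModuleCat.{v} R) (ComplexShape.up ℤ) q).map_zsmul

/-- Multiplication by `n` on `K` induces multiplication by `n` on `H^q(K)`. [folklore] -/
theorem homologyMap_zsmul_id_apply (K : CochainComplex (ModuleCat.{v} R) ℤ) (n q : ℤ)
    (x : K.homology q) : homologyMap (n • 𝟙 K) q x = n • x := by
  rw [homologyMap_zsmul, homologyMap_id]
  simp

/-- Naturality of the connecting maps `homologyδOfTriangle` in the triangle (Mathlib records the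
three exactness statements but not this square). [folklore] -/
theorem homologyδOfTriangle_naturality
    {T T' : Pretriangulated.Triangle (CochainComplex (ModuleCat.{v} R) ℤ)} (f : T ⟶ T')
    (n₀ n₁ : ℤ) (h : n₀ + 1 = n₁) :
    homologyδOfTriangle T n₀ n₁ h ≫ homologyMap f.hom₁ n₁ =
      homologyMap f.hom₃ n₀ ≫ homologyδOfTriangle T' n₀ n₁ h := by
  change (homologyFunctor (ModuleCat.{v} R) (ComplexShape.up ℤ) 0).shiftMap T.mor₃ n₀ n₁
      (by omega) ≫ ((homologyFunctor _ _ 0).shift n₁).map f.hom₁ =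
    ((homologyFunctor _ _ 0).shift n₀).map f.hom₃ ≫
      (homologyFunctor (ModuleCat.{v} R) (ComplexShape.up ℤ) 0).shiftMap T'.mor₃ n₀ n₁
        (by omega)
  rw [← Functor.shiftMap_comp, ← Functor.shiftMap_comp', f.comm₃]

variable (K : CochainComplex (ModuleCat.{v} R) ℤ) (n : ℤ)

/-- **The mod-`n` reduction `K/ⁿ := Cone(n • 𝟙_K)` of a cochain complex of modules** — the
standard model of `K ⊗ᴸ ℤ/n`; its cohomology `H^q(K/ⁿ)` is the mod-`n` (hyper)cohomology
`H^q(K; ℤ/n)` of X. Hu's Lemma 10.2 (there for chain complexes of abelian groups, `R = ℤ`).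
[cite: Hu2025TruncatedWitt, Lemma 10.2 (p. 52)] -/
noncomputable abbrev modCone : CochainComplex (ModuleCat.{v} R) ℤ :=
  mappingCone (n • 𝟙 K)

/-- The reduction map `ι : K ⟶ K/ⁿ` (second inclusion into the cone). [folklore] -/
noncomputable abbrev modConeι : K ⟶ modCone K n :=
  mappingCone.inr (n • 𝟙 K)

/-- The Bockstein `δ : H^q(K; ℤ/n) ⟶ H^{q+1}(K)` (connecting map of the cone triangle
`K →ⁿ K → K/ⁿ → K⟦1⟧`). [folklore] -/
noncomputable def modConeδ (q q' : ℤ) (h : q + 1 = q') : (modCone K n).homology q ⟶ K.homology q' :=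
  homologyδOfTriangle (mappingCone.triangle (n • 𝟙 K)) q q' h

variable {K} {L : CochainComplex (ModuleCat.{v} R) ℤ}

/-- Functoriality `φ/ⁿ : K/ⁿ ⟶ L/ⁿ` of the mod-`n` reduction (`n • 𝟙` commutes with every `φ`).
[folklore] -/
noncomputable def modConeMap (φ : K ⟶ L) (n : ℤ) : modCone K n ⟶ modCone L n :=
  mappingCone.map (n • 𝟙 K) (n • 𝟙 L) φ φ (by simp)

variable (K)

/-- Exactness of `H^q(K) →ⁿ H^q(K) →ι H^q(K; ℤ/n)`: a class reducing to `0` mod `n` is divisible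
by `n`. [folklore] -/
theorem exists_zsmul_eq_of_modConeι_apply_eq_zero (q : ℤ) (y : K.homology q)
    (hy : homologyMap (modConeι K n) q y = 0) : ∃ x : K.homology q, n • x = y := by
  letI := HasDerivedCategory.standard (ModuleCat.{v} R)
  obtain ⟨x, hx⟩ := (ShortComplex.moduleCat_exact_iff _).1
    (CochainComplex.homologyMap_exact₂_of_distTriang _
      (DerivedCategory.mappingCone_triangle_distinguished (n • 𝟙 K)) q) y hy
  exact ⟨x, (homologyMap_zsmul_id_apply K n q x).symm.trans hx⟩

/-- Exactness of `H^q(K) →ι H^q(K; ℤ/n) →δ H^{q+1}(K)`: a mod-`n` class with zero Bockstein is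
the reduction of an integral class. [folklore] -/
theorem exists_modConeι_apply_eq_of_modConeδ_apply_eq_zero (q q' : ℤ) (h : q + 1 = q')
    (z : (modCone K n).homology q) (hz : modConeδ K n q q' h z = 0) :
    ∃ y : K.homology q, homologyMap (modConeι K n) q y = z := by
  letI := HasDerivedCategory.standard (ModuleCat.{v} R)
  exact (ShortComplex.moduleCat_exact_iff _).1
    (CochainComplex.homologyMap_exact₃_of_distTriang _
      (DerivedCategory.mappingCone_triangle_distinguished (n • 𝟙 K)) q q' h) z hz

/-- Exactness of `H^q(K; ℤ/n) →δ H^{q+1}(K) →ⁿ H^{q+1}(K)`: every `n`-torsion class is a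
Bockstein. [folklore] -/
theorem exists_modConeδ_apply_eq_of_zsmul_eq_zero (q q' : ℤ) (h : q + 1 = q')
    (w : K.homology q') (hw : n • w = 0) :
    ∃ z : (modCone K n).homology q, modConeδ K n q q' h z = w := by
  letI := HasDerivedCategory.standard (ModuleCat.{v} R)
  exact (ShortComplex.moduleCat_exact_iff _).1
    (CochainComplex.homologyMap_exact₁_of_distTriang _
      (DerivedCategory.mappingCone_triangle_distinguished (n • 𝟙 K)) q q' h) w
    ((homologyMap_zsmul_id_apply K n q' w).trans hw)

/-- Bocksteins are `n`-torsion (`δ ≫ n = 0`). [folklore] -/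
theorem zsmul_modConeδ_apply (q q' : ℤ) (h : q + 1 = q') (z : (modCone K n).homology q) :
    n • modConeδ K n q q' h z = 0 := by
  letI := HasDerivedCategory.standard (ModuleCat.{v} R)
  exact (homologyMap_zsmul_id_apply K n q' _).symm.trans
    (apply_apply_eq_zero_of_comp_eq_zero (CochainComplex.homologyδOfTriangle_homologyMap _
      (DerivedCategory.mappingCone_triangle_distinguished (n • 𝟙 K)) q q' h) z)

/-- `δ ∘ ι = 0`: reductions of integral classes have zero Bockstein. [folklore] -/
theorem modConeδ_apply_modConeι_apply (q q' : ℤ) (h : q + 1 = q') (y : K.homology q) :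
    modConeδ K n q q' h (homologyMap (modConeι K n) q y) = 0 := by
  letI := HasDerivedCategory.standard (ModuleCat.{v} R)
  exact apply_apply_eq_zero_of_comp_eq_zero (CochainComplex.homologyMap_homologyδOfTriangle _
    (DerivedCategory.mappingCone_triangle_distinguished (n • 𝟙 K)) q q' h) y

variable {K}

/-- Naturality of the reduction: `(φ/ⁿ)_* ∘ ι_* = ι_* ∘ φ_*` on cohomology. [folklore] -/
theorem modConeMap_apply_modConeι_apply (φ : K ⟶ L) (q : ℤ) (y : K.homology q) :
    homologyMap (modConeMap φ n) q (homologyMap (modConeι K n) q y) =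
      homologyMap (modConeι L n) q (homologyMap φ q y) := by
  have hc := (mappingCone.triangleMap (n • 𝟙 K) (n • 𝟙 L) φ φ (by simp)).comm₂
  have hc' : homologyMap (modConeι K n) q ≫ homologyMap (modConeMap φ n) q =
      homologyMap φ q ≫ homologyMap (modConeι L n) q := by
    rw [← homologyMap_comp, ← homologyMap_comp]
    exact congrArg (fun k ↦ homologyMap k q) hc
  exact apply_apply_eq_of_comp_eq hc' y

/-- Naturality of the Bockstein: `φ_* ∘ δ = δ ∘ (φ/ⁿ)_*`. [folklore] -/
theorem homologyMap_apply_modConeδ_apply (φ : K ⟶ L) (q q' : ℤ) (h : q + 1 = q')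
    (z : (modCone K n).homology q) :
    homologyMap φ q' (modConeδ K n q q' h z) =
      modConeδ L n q q' h (homologyMap (modConeMap φ n) q z) :=
  apply_apply_eq_of_comp_eq (homologyδOfTriangle_naturality
    (mappingCone.triangleMap (n • 𝟙 K) (n • 𝟙 L) φ φ (by simp)) q q' h) z

/-! ### Hu's Lemma 10.2 for complexes -/

/-- **Injectivity in degree `q`** (X. Hu, Lemma 10.2, degreewise form): if `H^q(φ; ℤ/n)` is
injective, `H^{q-1}(φ; ℤ/n)` is onto and `H^q(K)` is killed by `n^M`, then `H^q(φ)` is injective.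
[cite: Hu2025TruncatedWitt, Lemma 10.2 (p. 52)] -/
theorem homologyMap_injective_of_modConeMap (φ : K ⟶ L) (n : ℤ) (M : ℕ) (q' q : ℤ)
    (h : q' + 1 = q) (hinj : Function.Injective (homologyMap (modConeMap φ n) q))
    (hsurj : Function.Surjective (homologyMap (modConeMap φ n) q'))
    (hK : ∀ x : K.homology q, n ^ M • x = 0) :
    Function.Injective (homologyMap φ q) :=
  injective_of_bockstein_ladder n M (homologyMap φ q).hom.toAddMonoidHom
    (homologyMap (modConeι K n) q).hom.toAddMonoidHom
    (homologyMap (modConeι L n) q).hom.toAddMonoidHom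
    (homologyMap (modConeMap φ n) q).hom.toAddMonoidHom
    (fun a ↦ modConeMap_apply_modConeι_apply n φ q a)
    (modConeδ K n q' q h).hom.toAddMonoidHom (modConeδ L n q' q h).hom.toAddMonoidHom
    (homologyMap (modConeMap φ n) q').hom.toAddMonoidHom
    (fun z ↦ homologyMap_apply_modConeδ_apply n φ q' q h z)
    (fun a ha ↦ by
      obtain ⟨a', ha'⟩ := exists_zsmul_eq_of_modConeι_apply_eq_zero K n q a ha
      exact ⟨a', ha'.symm⟩)
    (fun z ↦ zsmul_modConeδ_apply K n q' q h z)
    (fun b hb ↦ exists_modConeδ_apply_eq_of_zsmul_eq_zero L n q' q h b hb)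
    hinj hsurj hK

/-- **Surjectivity in degree `q`** (X. Hu, Lemma 10.2, degreewise form): if `H^q(φ; ℤ/n)` is
onto, `H^{q+1}(φ; ℤ/n)` is injective, `H^q(L)` and `H^{q+1}(K)` are killed by `n^M`, then
`H^q(φ)` is onto (the injectivity of `H^{q+1}(φ)` it needs is the previous statement).
[cite: Hu2025TruncatedWitt, Lemma 10.2 (p. 52)] -/
theorem homologyMap_surjective_of_modConeMap (φ : K ⟶ L) (n : ℤ) (M : ℕ) (q q' : ℤ)
    (h : q + 1 = q') (hsurj : Function.Surjective (homologyMap (modConeMap φ n) q))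
    (hinj : Function.Injective (homologyMap (modConeMap φ n) q'))
    (hL : ∀ y : L.homology q, n ^ M • y = 0) (hK : ∀ x : K.homology q', n ^ M • x = 0) :
    Function.Surjective (homologyMap φ q) :=
  surjective_of_bockstein_ladder n M (homologyMap φ q).hom.toAddMonoidHom
    (homologyMap φ q').hom.toAddMonoidHom
    (homologyMap (modConeι K n) q).hom.toAddMonoidHom
    (homologyMap (modConeι L n) q).hom.toAddMonoidHom
    (homologyMap (modConeMap φ n) q).hom.toAddMonoidHom
    (fun a ↦ modConeMap_apply_modConeι_apply n φ q a)
    (modConeδ K n q q' h).hom.toAddMonoidHom (modConeδ L n q q' h).hom.toAddMonoidHom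
    (fun z ↦ homologyMap_apply_modConeδ_apply n φ q q' h z)
    (fun z hz ↦ exists_modConeι_apply_eq_of_modConeδ_apply_eq_zero K n q q' h z hz)
    (fun b ↦ modConeδ_apply_modConeι_apply L n q q' h b)
    (fun b hb ↦ by
      obtain ⟨b', hb'⟩ := exists_zsmul_eq_of_modConeι_apply_eq_zero L n q b hb
      exact ⟨b', hb'.symm⟩)
    hsurj (homologyMap_injective_of_modConeMap φ n M q q' h hinj hsurj hK) hL

/-- **X. Hu, Lemma 10.2** (arXiv:2507.12458, p. 52), cohomological indexing (`Kq = C₋q`,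
`q₀ = -n`): let `φ : K ⟶ L` be a morphism of cochain complexes of `R`-modules (abelian groups:
`R = ℤ`) and `n` an integer (there: a prime `p`). If the mod-`n` maps
`H^q(K; ℤ/n) → H^q(L; ℤ/n)` are bijective for `q ≥ q₀` and onto for `q = q₀ - 1`, and `H^q(K)`,
`H^q(L)` are killed by `n^M` for `q ≥ q₀ - 1`, then `H^q(K) → H^q(L)` is bijective for `q ≥ q₀`
and onto for `q = q₀ - 1`. (The printed hypothesis that the complexes be bounded below is not
used.) [cite: Hu2025TruncatedWitt, Lemma 10.2 (p. 52)] -/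
theorem homologyMap_bijective_of_modConeMap_bijective (φ : K ⟶ L) (n : ℤ) (M : ℕ) (q₀ : ℤ)
    (hbij : ∀ q, q₀ ≤ q → Function.Bijective (homologyMap (modConeMap φ n) q))
    (hsurj : Function.Surjective (homologyMap (modConeMap φ n) (q₀ - 1)))
    (hK : ∀ q, q₀ - 1 ≤ q → ∀ x : K.homology q, n ^ M • x = 0)
    (hL : ∀ q, q₀ - 1 ≤ q → ∀ y : L.homology q, n ^ M • y = 0) :
    (∀ q, q₀ ≤ q → Function.Bijective (homologyMap φ q)) ∧
      Function.Surjective (homologyMap φ (q₀ - 1)) := by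
  -- the mod-`n` map is onto in every degree `≥ q₀ - 1`
  have hsurj' : ∀ q, q₀ - 1 ≤ q → Function.Surjective (homologyMap (modConeMap φ n) q) := by
    intro q hq
    rcases eq_or_lt_of_le hq with rfl | hlt
    · exact hsurj
    · exact (hbij q (by omega)).2
  have hinj : ∀ q, q₀ ≤ q → Function.Injective (homologyMap φ q) := fun q hq ↦
    homologyMap_injective_of_modConeMap φ n M (q - 1) q (by omega) (hbij q hq).1
      (hsurj' (q - 1) (by omega)) (hK q (by omega))
  have hsur : ∀ q, q₀ - 1 ≤ q → Function.Surjective (homologyMap φ q) := fun q hq ↦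
    homologyMap_surjective_of_modConeMap φ n M q (q + 1) rfl (hsurj' q hq)
      (hbij (q + 1) (by omega)).1 (hL q hq) (hK (q + 1) (by omega))
  exact ⟨fun q hq ↦ ⟨hinj q hq, hsur q (by omega)⟩, hsur (q₀ - 1) le_rfl⟩

end Complexes

end Literature.Algebra.Homology
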